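import Summits.Ventures.PercRepro.BlockSumProfiles

/-!
# PercRepro — block ⊕ generic points: the fibre counts for an arbitrary block (p9, gen 13)

`proofs/P9-S4-LINELADDER-g13.md` §6: for ANY finite block `B` and `F` (`m` points in general position), the subsets
`A ⊆ B.E ⊔ F` fall into the fibres `A ∩ B.E = X`, `|A ∩ F| = a`, of size `C(m, a)`; a family cut out by a predicate on
`(A ∩ B.E, |A ∩ F|)` is counted fibrewise (`ncard_setOf_fibre_subset`). Together with `disjointSum_eRk_eq` and
`truncate_eRk` this writes `#U` and `#Y` of `T_p(B ⊕ U_{m,m})` as sums over the subsets of `B.E` of binomials in `m`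
(`ncard_U_blockFree`, `ncard_Y_blockFree`); with the generic step of `BlockSumProfiles` this gives the META-THEOREM
`rls_blockFree_of_base`: C-025 on `T_p(B ⊕ U_{m,m})` for every `m ≥ m₀` from the base-layer inequalities at `m₀`.
-/

namespace PercRepro.LineLadder

open Set Finset

variable {α : Type}

/-- **The fibre with a prescribed block part**: for finite disjoint `E`, `F`, the subsets `A ⊆ E ∪ F` with `A ∩ E = X`
(`X ⊆ E`) and `|A ∩ F| = a` number `C(|F|, a)`. -/
theorem ncard_fibre_subset {E F : Set α} (hF : F.Finite) (hEF : Disjoint E F) {X : Set α} (hX : X ⊆ E) (a : ℕ) :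
    {A : Set α | A ⊆ E ∪ F ∧ A ∩ E = X ∧ (A ∩ F).ncard = a}.ncard = F.ncard.choose a := by
  have himg : {A : Set α | A ⊆ E ∪ F ∧ A ∩ E = X ∧ (A ∩ F).ncard = a}
      = (fun B : Set α => X ∪ B) '' {B : Set α | B ⊆ F ∧ B.ncard = a} := by
    ext A
    simp only [mem_setOf_eq, mem_image]
    constructor
    · rintro ⟨hAE, hX', ha⟩
      refine ⟨A ∩ F, ⟨inter_subset_right, ha⟩, ?_⟩
      rw [← hX', ← inter_union_distrib_left, inter_eq_left.2 hAE]
    · rintro ⟨B, ⟨hBF, hBa⟩, rfl⟩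
      have hXF : X ∩ F = ∅ := disjoint_iff_inter_eq_empty.1 (hEF.mono_left hX)
      have hBE : B ∩ E = ∅ := disjoint_iff_inter_eq_empty.1 (hEF.symm.mono_left hBF)
      refine ⟨union_subset_union hX hBF, ?_, ?_⟩
      · rw [union_inter_distrib_right, inter_eq_left.2 hX, hBE, union_empty]
      · rw [union_inter_distrib_right, hXF, empty_union, inter_eq_left.2 hBF, hBa]
  have hinj : Set.InjOn (fun B : Set α => X ∪ B) {B : Set α | B ⊆ F ∧ B.ncard = a} := by
    rintro B ⟨hBF, -⟩ B' ⟨hBF', -⟩ hBB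
    simp only at hBB
    have hXF : X ∩ F = ∅ := disjoint_iff_inter_eq_empty.1 (hEF.mono_left hX)
    calc B = (X ∪ B) ∩ F := by rw [union_inter_distrib_right, hXF, empty_union, inter_eq_left.2 hBF]
      _ = (X ∪ B') ∩ F := by rw [hBB]
      _ = B' := by rw [union_inter_distrib_right, hXF, empty_union, inter_eq_left.2 hBF']
  rw [himg, hinj.ncard_image, Set.ncard_powerset_ncard hF]

/-- **Fibrewise counting with a prescribed block part**: a family of subsets of `E ⊔ F` cut out by a predicate on
`(A ∩ E, |A ∩ F|)` has `Σ_{X ⊆ E} Σ_{a ≤ |F|} [P X a]·C(|F|, a)` members. -/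
theorem ncard_setOf_fibre_subset {E F : Set α} (hE : E.Finite) (hF : F.Finite) (hEF : Disjoint E F)
    (P : Set α → ℕ → Prop) [∀ X a, Decidable (P X a)] :
    {A : Set α | A ⊆ E ∪ F ∧ P (A ∩ E) (A ∩ F).ncard}.ncard
      = ∑ X ∈ hE.finite_subsets.toFinset, ∑ a ∈ range (F.ncard + 1), if P X a then F.ncard.choose a else 0 := by
  classical
  set T := {A : Set α | A ⊆ E ∪ F ∧ P (A ∩ E) (A ∩ F).ncard} with hTdef
  have hT : T.Finite := (hE.union hF).finite_subsets.subset fun A hA => hA.1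
  set f : Set α → Set α × ℕ := fun A => (A ∩ E, (A ∩ F).ncard) with hfdef
  set S : Finset (Set α × ℕ) := hE.finite_subsets.toFinset ×ˢ range (F.ncard + 1) with hSdef
  have hmaps : Set.MapsTo f (hT.toFinset : Set (Set α)) (S : Set (Set α × ℕ)) := by
    intro A _
    simp only [hSdef, Finset.coe_product, Finset.coe_range, Set.mem_prod, Set.mem_Iio, hfdef,
      Set.Finite.coe_toFinset, mem_setOf_eq]
    exact ⟨inter_subset_right, Nat.lt_succ_of_le (Set.ncard_le_ncard inter_subset_right hF)⟩
  rw [Set.ncard_eq_toFinset_card T hT, Finset.card_eq_sum_card_fiberwise hmaps, hSdef, Finset.sum_product]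
  refine Finset.sum_congr rfl fun X hX => Finset.sum_congr rfl fun a _ => ?_
  rw [Set.Finite.mem_toFinset, mem_setOf_eq] at hX
  have hcoe : ((hT.toFinset.filter fun A => f A = (X, a) : Finset (Set α)) : Set (Set α))
      = {A : Set α | A ∈ T ∧ f A = (X, a)} := by
    ext A; simp [Set.Finite.mem_toFinset]
  rw [← Set.ncard_coe_finset, hcoe]
  by_cases hP : P X a
  · rw [if_pos hP, ← ncard_fibre_subset hF hEF hX a]
    congr 1
    ext A
    simp only [mem_setOf_eq, hTdef, hfdef, Prod.mk.injEq]
    constructor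
    · rintro ⟨⟨hAE, -⟩, hk, ha⟩; exact ⟨hAE, hk, ha⟩
    · rintro ⟨hAE, hk, ha⟩; exact ⟨⟨hAE, by rw [hk, ha]; exact hP⟩, hk, ha⟩
  · rw [if_neg hP]
    have : {A : Set α | A ∈ T ∧ f A = (X, a)} = ∅ := by
      rw [Set.eq_empty_iff_forall_notMem]
      rintro A ⟨⟨-, hPA⟩, hfA⟩
      simp only [hfdef, Prod.mk.injEq] at hfA
      exact hP (hfA.1 ▸ hfA.2 ▸ hPA)
    rw [this, Set.ncard_empty]

/-! ### `T_p(B ⊕ U_{m,m})` for an arbitrary finite block `B` -/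

/-- The ground set of `B ⊕ freeOn F` is finite. -/
theorem blockFree_finite (B : Matroid α) [B.Finite] {F : Set α} (hF : F.Finite) (hBF : Disjoint B.E (Matroid.freeOn F).E) :
    (B.disjointSum (Matroid.freeOn F) hBF).Finite := by
  refine ⟨?_⟩
  rw [Matroid.disjointSum_ground_eq, Matroid.freeOn_ground]
  exact B.ground_finite.union hF

/-- The rank function of `T_p(B ⊕ U_{m,m})` on `X ⊆ B.E ∪ F`: `min (ρ_B(X ∩ B.E) + |X ∩ F|) p`. -/
theorem blockFree_eRk (B : Matroid α) [B.Finite] {F : Set α} (hF : F.Finite) (hBF : Disjoint B.E (Matroid.freeOn F).E)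
    (p : ℕ) {X : Set α} (hX : X ⊆ B.E ∪ F) :
    (@PercRepro.Matroid.truncate α (B.disjointSum (Matroid.freeOn F) hBF) (blockFree_finite B hF hBF) p).eRk X
      = min (B.eRk (X ∩ B.E) + ((X ∩ F).ncard : ℕ∞)) p := by
  rw [PercRepro.Matroid.truncate_eRk, disjointSum_eRk_eq _ (by rwa [Matroid.freeOn_ground]), Matroid.freeOn_ground,
    Matroid.eRk_freeOn inter_subset_right, (hF.subset inter_subset_right).cast_ncard_eq]

/-- **`#U` of `T_p(B ⊕ U_{m,m})`** as a double sum over the subsets `X` of `B.E` and the sizes `a` of the generic part: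
the fibre `(X, a)` is in `U` iff `min (ρ_B X + a) p = p` and `min (ρ_B(B.E ∖ X) + (m − a)) p = q`. -/
theorem ncard_U_blockFree (B : Matroid α) [B.Finite] {F : Set α} (hF : F.Finite)
    (hBF : Disjoint B.E (Matroid.freeOn F).E) (p q : ℕ) :
    {A : Set α | A ⊆ (@PercRepro.Matroid.truncate α (B.disjointSum (Matroid.freeOn F) hBF) (blockFree_finite B hF hBF) p).E
        ∧ (@PercRepro.Matroid.truncate α (B.disjointSum (Matroid.freeOn F) hBF) (blockFree_finite B hF hBF) p).eRk A = (p : ℕ∞)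
        ∧ (@PercRepro.Matroid.truncate α (B.disjointSum (Matroid.freeOn F) hBF) (blockFree_finite B hF hBF) p).eRk
            ((@PercRepro.Matroid.truncate α (B.disjointSum (Matroid.freeOn F) hBF) (blockFree_finite B hF hBF) p).E \ A)
            = (q : ℕ∞)}.ncard
      = ∑ X ∈ B.ground_finite.finite_subsets.toFinset, ∑ a ∈ range (F.ncard + 1),
          if min (B.eRk X + (a : ℕ∞)) p = p ∧ min (B.eRk (B.E \ X) + ((F.ncard - a : ℕ) : ℕ∞)) p = q
            then F.ncard.choose a else 0 := by
  classical
  have hBF' : Disjoint B.E F := by rwa [Matroid.freeOn_ground] at hBF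
  have hE : (@PercRepro.Matroid.truncate α (B.disjointSum (Matroid.freeOn F) hBF) (blockFree_finite B hF hBF) p).E
      = B.E ∪ F := by
    rw [PercRepro.Matroid.truncate_ground, Matroid.disjointSum_ground_eq, Matroid.freeOn_ground]
  have hset : {A : Set α | A ⊆ (@PercRepro.Matroid.truncate α (B.disjointSum (Matroid.freeOn F) hBF) (blockFree_finite B hF hBF) p).E
        ∧ (@PercRepro.Matroid.truncate α (B.disjointSum (Matroid.freeOn F) hBF) (blockFree_finite B hF hBF) p).eRk A = (p : ℕ∞)
        ∧ (@PercRepro.Matroid.truncate α (B.disjointSum (Matroid.freeOn F) hBF) (blockFree_finite B hF hBF) p).eRk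
            ((@PercRepro.Matroid.truncate α (B.disjointSum (Matroid.freeOn F) hBF) (blockFree_finite B hF hBF) p).E \ A)
            = (q : ℕ∞)}
      = {A : Set α | A ⊆ B.E ∪ F ∧ (fun (X : Set α) (a : ℕ) => min (B.eRk X + (a : ℕ∞)) p = p
          ∧ min (B.eRk (B.E \ X) + ((F.ncard - a : ℕ) : ℕ∞)) p = q) (A ∩ B.E) (A ∩ F).ncard} := by
    ext A
    simp only [mem_setOf_eq, hE]
    constructor
    · rintro ⟨hAE, h1, h2⟩
      rw [blockFree_eRk B hF hBF p hAE] at h1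
      rw [blockFree_eRk B hF hBF p sdiff_subset] at h2
      have e1 : (B.E ∪ F) \ A ∩ B.E = B.E \ (A ∩ B.E) := by
        ext x; simp only [Set.mem_inter_iff, Set.mem_sdiff, Set.mem_union]; tauto
      have e2 : ((B.E ∪ F) \ A ∩ F).ncard = F.ncard - (A ∩ F).ncard :=
        ncard_compl_inter hF subset_union_right
      rw [e1, e2] at h2
      exact ⟨hAE, h1, h2⟩
    · rintro ⟨hAE, h1, h2⟩
      refine ⟨hAE, ?_, ?_⟩
      · rw [blockFree_eRk B hF hBF p hAE]; exact h1
      · rw [blockFree_eRk B hF hBF p sdiff_subset]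
        have e1 : (B.E ∪ F) \ A ∩ B.E = B.E \ (A ∩ B.E) := by
          ext x; simp only [Set.mem_inter_iff, Set.mem_sdiff, Set.mem_union]; tauto
        have e2 : ((B.E ∪ F) \ A ∩ F).ncard = F.ncard - (A ∩ F).ncard :=
          ncard_compl_inter hF subset_union_right
        rw [e1, e2]; exact h2
  rw [hset, ncard_setOf_fibre_subset B.ground_finite hF hBF' (fun (X : Set α) (a : ℕ) => min (B.eRk X + (a : ℕ∞)) p = p
      ∧ min (B.eRk (B.E \ X) + ((F.ncard - a : ℕ) : ℕ∞)) p = q)]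

/-- **`#Y` of `T_p(B ⊕ U_{m,m})`** as a double sum: the fibre `(X, a)` is in `Y` iff `q < min (ρ_B X + a) p < p`. -/
theorem ncard_Y_blockFree (B : Matroid α) [B.Finite] {F : Set α} (hF : F.Finite)
    (hBF : Disjoint B.E (Matroid.freeOn F).E) (p q : ℕ) :
    {A : Set α | A ⊆ (@PercRepro.Matroid.truncate α (B.disjointSum (Matroid.freeOn F) hBF) (blockFree_finite B hF hBF) p).E
        ∧ (q : ℕ∞) < (@PercRepro.Matroid.truncate α (B.disjointSum (Matroid.freeOn F) hBF) (blockFree_finite B hF hBF) p).eRk A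
        ∧ (@PercRepro.Matroid.truncate α (B.disjointSum (Matroid.freeOn F) hBF) (blockFree_finite B hF hBF) p).eRk A < (p : ℕ∞)}.ncard
      = ∑ X ∈ B.ground_finite.finite_subsets.toFinset, ∑ a ∈ range (F.ncard + 1),
          if (q : ℕ∞) < min (B.eRk X + (a : ℕ∞)) p ∧ min (B.eRk X + (a : ℕ∞)) p < (p : ℕ∞)
            then F.ncard.choose a else 0 := by
  classical
  have hBF' : Disjoint B.E F := by rwa [Matroid.freeOn_ground] at hBF
  have hE : (@PercRepro.Matroid.truncate α (B.disjointSum (Matroid.freeOn F) hBF) (blockFree_finite B hF hBF) p).E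
      = B.E ∪ F := by
    rw [PercRepro.Matroid.truncate_ground, Matroid.disjointSum_ground_eq, Matroid.freeOn_ground]
  have hset : {A : Set α | A ⊆ (@PercRepro.Matroid.truncate α (B.disjointSum (Matroid.freeOn F) hBF) (blockFree_finite B hF hBF) p).E
        ∧ (q : ℕ∞) < (@PercRepro.Matroid.truncate α (B.disjointSum (Matroid.freeOn F) hBF) (blockFree_finite B hF hBF) p).eRk A
        ∧ (@PercRepro.Matroid.truncate α (B.disjointSum (Matroid.freeOn F) hBF) (blockFree_finite B hF hBF) p).eRk A < (p : ℕ∞)}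
      = {A : Set α | A ⊆ B.E ∪ F ∧ (fun (X : Set α) (a : ℕ) => (q : ℕ∞) < min (B.eRk X + (a : ℕ∞)) p
          ∧ min (B.eRk X + (a : ℕ∞)) p < (p : ℕ∞)) (A ∩ B.E) (A ∩ F).ncard} := by
    ext A
    simp only [mem_setOf_eq, hE]
    constructor
    · rintro ⟨hAE, h1, h2⟩
      rw [blockFree_eRk B hF hBF p hAE] at h1 h2
      exact ⟨hAE, h1, h2⟩
    · rintro ⟨hAE, h1, h2⟩
      refine ⟨hAE, ?_, ?_⟩ <;> rw [blockFree_eRk B hF hBF p hAE] <;> assumption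
  rw [hset, ncard_setOf_fibre_subset B.ground_finite hF hBF' (fun (X : Set α) (a : ℕ) =>
    (q : ℕ∞) < min (B.eRk X + (a : ℕ∞)) p ∧ min (B.eRk X + (a : ℕ∞)) p < (p : ℕ∞))]

/-! ### The meta-theorem on matroids: `T_p(B ⊕ U_{m,m})` satisfies C-025 once its base layer does -/

/-- The rank of a subset of the ground set of a finite matroid is a natural number. -/
lemma eRk_eq_toNat (B : Matroid α) [B.Finite] {X : Set α} (hX : X ⊆ B.E) : B.eRk X = ((B.eRk X).toNat : ℕ∞) :=
  (ENat.coe_toNat (B.isRkFinite_of_finite (B.ground_finite.subset hX)).eRk_lt_top.ne).symm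


/-- The `U`-condition, cast from `ℕ∞` to `ℕ`. -/
lemma condU_cast (p q m a k₁ k₂ : ℕ) :
    (min ((k₁ : ℕ∞) + (a : ℕ∞)) (p : ℕ∞) = (p : ℕ∞) ∧ min ((k₂ : ℕ∞) + ((m - a : ℕ) : ℕ∞)) (p : ℕ∞) = (q : ℕ∞))
      ↔ (min p (k₁ + a) = p ∧ min p (k₂ + (m - a)) = q) := by
  rw [← Nat.cast_add, ← Nat.cast_add, ← Nat.mono_cast.map_min, ← Nat.mono_cast.map_min, Nat.cast_inj, Nat.cast_inj,
    min_comm (k₁ + a), min_comm (k₂ + (m - a))]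

/-- The `Y`-condition, cast from `ℕ∞` to `ℕ`. -/
lemma condY_cast (p q a k₁ : ℕ) :
    ((q : ℕ∞) < min ((k₁ : ℕ∞) + (a : ℕ∞)) (p : ℕ∞) ∧ min ((k₁ : ℕ∞) + (a : ℕ∞)) (p : ℕ∞) < (p : ℕ∞))
      ↔ (q < min p (k₁ + a) ∧ min p (k₁ + a) < p) := by
  rw [← Nat.cast_add, ← Nat.mono_cast.map_min, Nat.cast_lt, Nat.cast_lt, min_comm (k₁ + a)]

/-- The `U`-count of `T_p(B ⊕ U_{m,m})` in profile form (`k₁ X = ρ_B X`, `k₂ X = ρ_B(B.E ∖ X)` as naturals). -/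
theorem ncard_U_blockFree' (B : Matroid α) [B.Finite] {F : Set α} (hF : F.Finite)
    (hBF : Disjoint B.E (Matroid.freeOn F).E) (p q : ℕ) :
    {A : Set α | A ⊆ (@PercRepro.Matroid.truncate α (B.disjointSum (Matroid.freeOn F) hBF) (blockFree_finite B hF hBF) p).E
        ∧ (@PercRepro.Matroid.truncate α (B.disjointSum (Matroid.freeOn F) hBF) (blockFree_finite B hF hBF) p).eRk A = (p : ℕ∞)
        ∧ (@PercRepro.Matroid.truncate α (B.disjointSum (Matroid.freeOn F) hBF) (blockFree_finite B hF hBF) p).eRk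
            ((@PercRepro.Matroid.truncate α (B.disjointSum (Matroid.freeOn F) hBF) (blockFree_finite B hF hBF) p).E \ A)
            = (q : ℕ∞)}.ncard
      = ∑ X ∈ B.ground_finite.finite_subsets.toFinset, ∑ a ∈ range (F.ncard + 1),
          if min p ((B.eRk X).toNat + a) = p ∧ min p ((B.eRk (B.E \ X)).toNat + (F.ncard - a)) = q
            then F.ncard.choose a else 0 := by
  rw [ncard_U_blockFree B hF hBF p q]
  refine Finset.sum_congr rfl fun X hX => Finset.sum_congr rfl fun a _ => ?_
  rw [Set.Finite.mem_toFinset, mem_setOf_eq] at hX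
  rw [eRk_eq_toNat B hX, eRk_eq_toNat B (sdiff_subset : B.E \ X ⊆ B.E)]
  simp only [ENat.toNat_coe]
  exact if_congr (condU_cast p q F.ncard a _ _) rfl rfl

/-- The `Y`-count of `T_p(B ⊕ U_{m,m})` in profile form. -/
theorem ncard_Y_blockFree' (B : Matroid α) [B.Finite] {F : Set α} (hF : F.Finite)
    (hBF : Disjoint B.E (Matroid.freeOn F).E) (p q : ℕ) :
    {A : Set α | A ⊆ (@PercRepro.Matroid.truncate α (B.disjointSum (Matroid.freeOn F) hBF) (blockFree_finite B hF hBF) p).E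
        ∧ (q : ℕ∞) < (@PercRepro.Matroid.truncate α (B.disjointSum (Matroid.freeOn F) hBF) (blockFree_finite B hF hBF) p).eRk A
        ∧ (@PercRepro.Matroid.truncate α (B.disjointSum (Matroid.freeOn F) hBF) (blockFree_finite B hF hBF) p).eRk A < (p : ℕ∞)}.ncard
      = ∑ X ∈ B.ground_finite.finite_subsets.toFinset, ∑ a ∈ range (F.ncard + 1),
          if q < min p ((B.eRk X).toNat + a) ∧ min p ((B.eRk X).toNat + a) < p then F.ncard.choose a else 0 := by
  rw [ncard_Y_blockFree B hF hBF p q]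
  refine Finset.sum_congr rfl fun X hX => Finset.sum_congr rfl fun a _ => ?_
  rw [Set.Finite.mem_toFinset, mem_setOf_eq] at hX
  rw [eRk_eq_toNat B hX]
  simp only [ENat.toNat_coe]
  exact if_congr (condY_cast p q a _) rfl rfl

/-- **C-025 ON `T_p(B ⊕ U_{m,m})` FROM ITS BASE LAYER** (the meta-theorem of P9-S4-LINELADDER-g13.md §6): let `B` be a
finite block and `m₀` a layer on which every profile `(ρ_B X, ρ_B(B.E ∖ X))` is active (`p + q ≤ ρ_B X + ρ_B(B.E ∖ X) + m₀`).
If the profile inequality `Φ(p−j, q−j)·U ≤ Y` holds at the base layer `m₀` for every `j ≤ q`, then `RLS` holds for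
`T_p(B ⊕ U_{m,m})` at `(p, q)` for every `m ≥ m₀` (`q + 2 ≤ p`). -/
theorem rls_blockFree_of_base (B : Matroid α) [B.Finite] {F : Set α} (hF : F.Finite)
    (hBF : Disjoint B.E (Matroid.freeOn F).E) (p q m₀ : ℕ) (hpq : q + 2 ≤ p)
    (hact : ∀ X ⊆ B.E, p + q ≤ (B.eRk X).toNat + (B.eRk (B.E \ X)).toNat + m₀)
    (hbase : ∀ j ≤ q, phiK (p - j) (q - j) *
        ((∑ X ∈ B.ground_finite.finite_subsets.toFinset, ∑ a ∈ range (m₀ + 1),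
          (if min (p - j) ((B.eRk X).toNat + a) = p - j ∧ min (p - j) ((B.eRk (B.E \ X)).toNat + (m₀ - a)) = q - j
            then m₀.choose a else 0) : ℕ) : ℚ)
      ≤ ((∑ X ∈ B.ground_finite.finite_subsets.toFinset, ∑ a ∈ range (m₀ + 1),
          (if q - j < min (p - j) ((B.eRk X).toNat + a) ∧ min (p - j) ((B.eRk X).toNat + a) < p - j
            then m₀.choose a else 0) : ℕ) : ℚ))
    (hm : m₀ ≤ F.ncard) :
    @ThmN.RLS α (@PercRepro.Matroid.truncate α (B.disjointSum (Matroid.freeOn F) hBF) (blockFree_finite B hF hBF) p)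
      (@PercRepro.Matroid.truncate_finite α _ (blockFree_finite B hF hBF) p) p q := by
  unfold ThmN.RLS
  rw [ncard_U_blockFree' B hF hBF p q, ncard_Y_blockFree' B hF hBF p q]
  exact profiles_ineq_of_base B.ground_finite.finite_subsets.toFinset (fun X => (B.eRk X).toNat)
    (fun X => (B.eRk (B.E \ X)).toNat) q p m₀ hpq
    (fun X hX => hact X (by rwa [Set.Finite.mem_toFinset, mem_setOf_eq] at hX)) hbase F.ncard hm

end PercRepro.LineLadder
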